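import Summits.BirchSwinnertonDyer.BirchSwinnertonDyer.Theorems.Rank2ShaOrderRow
import Summits.BirchSwinnertonDyer.BirchSwinnertonDyer.Theorems.Rank2ShaOrderKatoRow
import Summits.BirchSwinnertonDyer.BirchSwinnertonDyer.Theorems.Rank2ShaSymbolValuation
import Summits.BirchSwinnertonDyer.BirchSwinnertonDyer.Theorems.Rank2ObservatoryPadicAtlasKit
import Summits.BirchSwinnertonDyer.BirchSwinnertonDyer.Theorems.Rank2ObservatoryTamagawaCert
import Summits.BirchSwinnertonDyer.BirchSwinnertonDyer.Theorems.Rank1ResidualIntModelReduction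
import HarnessLib

/-!
# BirchSwinnertonDyer — rank-2 `Ш[p^∞]` cell: the ROW KIT (one kernel test per census row, then
# `#Ш(E/ℚ)[p^∞] = p^k` with every integer of `k` computed in the kernel)

HONEST FRAMING (cell `b2b-bsdr2sha`, run/shared/lean/b2b/bsd-rank2-sha/): per-pair certified
theorems «cited hypotheses ∧ certified computation ⇒ `Ш(E/ℚ)[p^∞]` finite of order `p^k`» for
rank-2 curves at good ordinary primes; NO claim on BSD in rank `≥ 2`, no class-level theorem, every
published input is a NAMED HYPOTHESIS of the tree (nothing is asserted or minted here).

A census row `(E, p)` of the cell is an observatory ATLAS CELL (`Rank2ObservatoryPadicAtlasKit.lean`: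
`AtlasCurve C` = census row + minimality bound + cells, `AtlasCell c` = `(p, a_p, n, A, tabHi, tabLo, H, L)`
the level-`p^{n+1}` symbol certificate; one Boolean `C.check && C.minCheck`, `decide +kernel`) PLUS,
new here, the kernel witnesses of the PRINTED hypotheses of Skinner–Urban's Thm. 3.6.9 and of the
local terms of the `p`-adic BSD leading term:

* `SuWitness = (ramL, ramSq, ramE, irrL, irrSq, irrN)`: a multiplicative prime `ℓ = ramL` of `E` with
  `ℓ^e ∥ Δ_min`, `p ∤ e` — S–U's "(ram)": `ρ̄_{E,p}` ramified at `ℓ ‖ N` (Tate curve) — and a good prime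
  `ℓ' = irrL ≠ p` with `#Ẽ(𝔽_ℓ') = irrN` whose Frobenius polynomial `X² − a_ℓ' X + ℓ'` has no root
  modulo `p` — `E[p]` IRREDUCIBLE (Mazur 1978 Prop. 6.3 (1)); the Boolean `SuWitness.check e p` and its
  soundness `ram_of_check`, `irr_of_check` through the rank-`≤ 1` cell's integer-model theorems
  `ram_of_intModel`, `hasIrreducibleModPGaloisRep_of_intModel_of_noroot`
  (`Rank1ResidualIntModelReduction.lean`);
* the Tamagawa product by the observatory's kernel row certificate `Tam.TamLocal.rowCheck Es e`
  (`Rank2ObservatoryTamagawaCert.lean`: Tate's algorithm outcomes per bad prime, `tamagawaProduct_eq`);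
* `#Ẽ(𝔽_p)` by the cell's Euler-criterion count (`AtlasCell.count`, `card_of_check`);
* `a = ord_p [T²] L_p = ord_p(A·H − L)` by `valuation_coeff_eq_of_symbolCertL` (`Rank2ShaSymbolValuation`).

ROW THEOREMS (per pair; NOT class theorems):
* `AtlasCurve.shaRowSU` — frame «su-exact»: GIVEN the named facts `hS` (Perrin-Riou–Schneider, BMS
  2016 Thm. 1.7), `hSU` (Skinner–Urban 2014 Thm. 3.6.9 for every cyclotomic datum), the newform `hf`,
  the census rank certificate `hlow : 2 ≤ rank`, the symbol DATA `hint`/`htab`, THE canonical height `Dh`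
  with its certified regulator valuation `hreg : ord_p Reg_p(E, Dh) = b` — and the KERNEL tests
  `C.check`, `c ∈ C.cells`, `w.check C.e c.p`, `rowCheck Es C.e`, `rowExact Es` —:
  `rank = 2`, `Ш(E/ℚ)[p^∞]` finite, `Reg_p ≠ 0`, and `#Ш(E/ℚ)[p^∞] = p^k` with
  `k = ord_p(c.A·c.H − c.L) + 2 − 2·ord_p(c.count C.e) − ord_p(rowValue Es) − b` — every term but `b` a
  kernel integer.
* `AtlasCurve.shaRowKato` — frame «kato-bound»: `hK` (Kato Thm. 17.4) instead of `hSU`, the census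
  surjectivity bit `hsurj : Surj W p` instead of the (ram) witness (only the `irr` half of `SuWitness` is
  unused; surjectivity is the printed hypothesis of Kato's integral clause) ⇒ `ord_p #Ш ≤ k`, and
  `#Ш(E/ℚ)[p^∞] = 1` when `k ≤ 0`.

References: C. Skinner, E. Urban, Invent. Math. 195 (2014), Thm. 3.6.9 [SkinnerUrban2014]; K. Kato,
Astérisque 295 (2004), Thm. 17.4 [Kato2004Asterisque]; B. Mazur, Invent. Math. 44 (1978), Prop. 6.3 (1)
[Mazur1978]; J. H. Silverman, *ATAEC* GTM 151 (1994), IV.9.4 and V Ex. 5.13 [SilvermanATAEC1994];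
W. Stein, C. Wuthrich, Math. Comp. 82 (2013), §§3–4, Alg. 11.1 [SteinWuthrich2013]; J. Balakrishnan,
J. S. Müller, W. Stein, Math. Comp. 85 (2016), Thm. 1.7 [BalakrishnanMullerStein2015].
-/

set_option autoImplicit false

-- single-conjunct summit: `Summit.BirchSwinnertonDyer.BirchSwinnertonDyer.…` repeats the name by design
set_option linter.dupNamespace false

noncomputable section

open scoped Classical MatrixGroups ModularForm

open CongruenceSubgroup WeierstrassCurve Literature.NumberTheory.EllipticCurves
  Literature.NumberTheory.EllipticCurves.ModularForms
  Literature.NumberTheory.EllipticCurves.Rank1Residual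
  Summit.BirchSwinnertonDyer.BirchSwinnertonDyer.Rank2Observatory
  Summit.BirchSwinnertonDyer.BirchSwinnertonDyer.Rank1Residual.IntModel

namespace Summit.BirchSwinnertonDyer.BirchSwinnertonDyer.Rank2Sha

/-! ## §1. The Skinner–Urban witness of a cell and its kernel test -/

/-- The KERNEL WITNESS of Skinner–Urban's printed hypotheses at a cell `(E, p)`: a multiplicative
prime `ramL` (trial-division datum `ramSq = ⌊√ramL⌋`) with `ramL^ramE ∥ Δ(e)` and `p ∤ ramE` — (ram):
`ρ̄_{E,p}` is ramified at `ramL ‖ N` —, and a good ODD prime `irrL ≠ p` (`irrSq = ⌊√irrL⌋`) with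
`#Ẽ(𝔽_{irrL}) = irrN` whose Frobenius polynomial has no root mod `p` — `E[p]` irreducible.
[cite: SkinnerUrban2014, Thm. 3.6.9 (p. 45)] [cite: Mazur1978, §6 Prop. 6.3 (1) (p. 153)] -/
structure SuWitness where
  /-- the multiplicative prime `ℓ ‖ N` of (ram) -/
  ramL : ℕ
  /-- `⌊√ramL⌋` (trial-division primality datum) -/
  ramSq : ℕ
  /-- `e = v_ℓ(Δ_min)`, with `p ∤ e` -/
  ramE : ℕ
  /-- the good prime `ℓ' ≠ p` of the Frobenius witness for irreducibility -/
  irrL : ℕ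
  /-- `⌊√irrL⌋` -/
  irrSq : ℕ
  /-- `#Ẽ(𝔽_{ℓ'})` -/
  irrN : ℕ
  deriving Repr, DecidableEq, Inhabited

/-- The kernel point count `#Ẽ(𝔽_ℓ) = 1 + eulerAffineCount` of an integer model at an odd good prime
(the observatory's Euler-criterion count, `natCard_point_eq_one_add_eulerAffineCount`). [folklore] -/
def curveCount (ℓ : ℕ) (e : WeierstrassCurve ℤ) : ℕ :=
  1 + eulerAffineCount ℓ e.a₁ e.a₂ e.a₃ e.a₄ e.a₆

/-- `curveCount ℓ e` IS `#Ẽ(𝔽_ℓ)` of the reduction of `e` at an odd prime `ℓ ∤ Δ(e)`. [folklore] -/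
theorem card_eq_curveCount (ℓ : ℕ) [Fact ℓ.Prime] (hℓ2 : ℓ ≠ 2) (e : WeierstrassCurve ℤ)
    (hΔ : ¬ ((ℓ : ℤ) ∣ e.Δ)) :
    Nat.card ((e.map (Int.castRingHom (ZMod ℓ))).toAffine.Point) = curveCount ℓ e := by
  have hΔ' : (e.map (Int.castRingHom (ZMod ℓ))).Δ ≠ 0 := by
    rw [WeierstrassCurve.map_Δ, eq_intCast, ne_eq, ZMod.intCast_zmod_eq_zero_iff_dvd]
    exact hΔ
  rw [natCard_point_eq_one_add_eulerAffineCount ℓ hℓ2 _ hΔ']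
  rfl

namespace SuWitness

variable (w : SuWitness)

/-- **The kernel test of a Skinner–Urban witness** against the integer model `e` at the prime `p`:
`ramL` prime, `≠ p`, `ramL ∣ Δ`, `ramL ∤ c₄` (multiplicative), `ramL^ramE ∥ Δ`, `p ∤ ramE`; `irrL` an
odd prime `≠ p`, `irrL ∤ Δ`, `curveCount irrL e = irrN`, and `t² − (irrL + 1 − irrN)·t + irrL ≢ 0 (mod p)`
for every `t < p`. [cite: SkinnerUrban2014, Thm. 3.6.9 (p. 45)] [cite: Mazur1978, §6 Prop. 6.3 (1) (p. 153)] -/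
def check (e : WeierstrassCurve ℤ) (p : ℕ) : Bool :=
  Tam.TamLocal.primeB w.ramL w.ramSq && decide (w.ramL ≠ p) && decide ((w.ramL : ℤ) ∣ e.Δ) &&
    decide (¬ ((w.ramL : ℤ) ∣ e.c₄)) && decide ((w.ramL : ℤ) ^ w.ramE ∣ e.Δ) &&
    decide (¬ ((w.ramL : ℤ) ^ (w.ramE + 1) ∣ e.Δ)) && decide (¬ (p ∣ w.ramE)) &&
    Tam.TamLocal.primeB w.irrL w.irrSq && decide (w.irrL ≠ 2) && decide (w.irrL ≠ p) &&
    decide (¬ ((w.irrL : ℤ) ∣ e.Δ)) && decide (curveCount w.irrL e = w.irrN) &&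
    (List.range p).all fun t =>
      !decide ((p : ℤ) ∣ (t : ℤ) ^ 2 - ((w.irrL : ℤ) + 1 - w.irrN) * t + w.irrL)

variable {w} {e : WeierstrassCurve ℤ} {p : ℕ} (h : w.check e p = true)
include h

/-- Unpacking a passing witness check. [folklore] -/
theorem check_spec :
    w.ramL.Prime ∧ w.ramL ≠ p ∧ (w.ramL : ℤ) ∣ e.Δ ∧ ¬ ((w.ramL : ℤ) ∣ e.c₄) ∧
      (w.ramL : ℤ) ^ w.ramE ∣ e.Δ ∧ ¬ ((w.ramL : ℤ) ^ (w.ramE + 1) ∣ e.Δ) ∧ ¬ (p ∣ w.ramE) ∧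
      w.irrL.Prime ∧ w.irrL ≠ 2 ∧ w.irrL ≠ p ∧ ¬ ((w.irrL : ℤ) ∣ e.Δ) ∧ curveCount w.irrL e = w.irrN ∧
      ∀ t : ℕ, t < p → ¬ ((p : ℤ) ∣ (t : ℤ) ^ 2 - ((w.irrL : ℤ) + 1 - w.irrN) * t + w.irrL) := by
  simp only [check, Bool.and_eq_true, decide_eq_true_eq, List.all_eq_true, List.mem_range,
    Bool.not_eq_true', decide_eq_false_iff_not] at h
  obtain ⟨⟨⟨⟨⟨⟨⟨⟨⟨⟨⟨⟨hP, hne⟩, hΔ⟩, hc4⟩, he⟩, he'⟩, hpe⟩, hP'⟩, h2⟩, hne'⟩, hΔ'⟩, hN⟩, hall⟩ := h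
  exact ⟨Tam.TamLocal.prime_of_primeB hP, hne, hΔ, hc4, he, he', hpe, Tam.TamLocal.prime_of_primeB hP',
    h2, hne', hΔ', hN, hall⟩

/-- **(ram) from the witness**: for `W/ℚ` globally minimal with integral model `e`, a passing
`SuWitness` gives `Ram W p` (a multiplicative `ℓ ≠ p` with `p ∤ v_ℓ(Δ_min)`; tree theorem
`ram_of_intModel`). [cite: SkinnerUrban2014, Thm. 3.6.9 (p. 45)] [cite: SilvermanAEC2009, VII.5 Prop. 5.1(b)] -/
theorem ram_of_check [Fact p.Prime] (W : WeierstrassCurve ℚ) [W.IsElliptic] [W.IsGloballyMinimal]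
    (hI : integralModelInt W = e) : Ram W p := by
  obtain ⟨hP, hne, hΔ, hc4, he, he', hpe, -⟩ := check_spec h
  exact ram_of_intModel hI p w.ramL hP hne hΔ hc4 he he' hpe

/-- **`E[p]` irreducible from the witness** (Frobenius witness at the good prime `irrL`: the
characteristic polynomial `X² − a_{ℓ'}X + ℓ'` has no root mod `p`, so no `Γ_ℚ`-stable line exists;
tree theorem `hasIrreducibleModPGaloisRep_of_intModel_of_noroot`). [cite: Mazur1978, §6 Prop. 6.3 (1) (p. 153)] -/
theorem irr_of_check [Fact p.Prime] (W : WeierstrassCurve ℚ) [W.IsElliptic] [W.IsGloballyMinimal]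
    (hI : integralModelInt W = e) : W.HasIrreducibleModPGaloisRep p := by
  obtain ⟨-, -, -, -, -, -, -, hP', h2, hne', hΔ', hN, hall⟩ := check_spec h
  haveI : Fact w.irrL.Prime := ⟨hP'⟩
  have hcard : Nat.card ((e.map (Int.castRingHom (ZMod w.irrL))).toAffine.Point) = w.irrN := by
    rw [card_eq_curveCount w.irrL h2 e hΔ', hN]
  refine hasIrreducibleModPGaloisRep_of_intModel_of_noroot hI p w.irrL hne' hΔ' hcard fun t ht => ?_
  have hp0 : 0 < p := (Fact.out : p.Prime).pos
  haveI : NeZero p := ⟨hp0.ne'⟩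
  have hu := hall t.val (ZMod.val_lt t)
  apply hu
  rw [← ZMod.intCast_zmod_eq_zero_iff_dvd, ← ht]
  push_cast
  rw [ZMod.natCast_zmod_val]

end SuWitness

/-! ## §2. Bookkeeping on an atlas cell: the census integers are the tree's invariants -/

section Cell

variable {C : AtlasCurve} (h : C.check = true) {c : AtlasCell} (hc : c ∈ C.cells)

/-- The integral model of an atlas curve's base change is its integer model. [folklore] -/
theorem AtlasCurve.integralModelInt_eq [(C.e.baseChange ℚ).IsGloballyMinimal] :
    integralModelInt (C.e.baseChange ℚ) = C.e :=
  integralModelInt_baseChange_int C.e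

include h hc in
/-- At a checking cell, the tree's `#Ẽ(𝔽_p)` (`reductionPointCount`) IS the kernel count `c.count C.e`.
[folklore] -/
theorem AtlasCurve.reductionPointCount_eq [Fact c.p.Prime] [(C.e.baseChange ℚ).IsGloballyMinimal] :
    (C.e.baseChange ℚ).reductionPointCount c.p = c.count C.e := by
  rw [reductionPointCount_baseChange_int, AtlasCell.card_of_check (AtlasCurve.cell_check h hc)]

end Cell

/-! ## §3. The row theorems on an atlas cell -/

/-- **ROW THEOREM, frame «su-exact», on an atlas cell.** For a checking atlas curve `C`, a cell
`c ∈ C.cells` (`p = c.p ≥ 5` good ordinary, symbol certificate valid — all in `C.check`), a passing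
Skinner–Urban witness `w` (`Ram`, `Irr` in the kernel), a passing EXACT Tamagawa row certificate `Es`
(`∏c_ℓ = rowValue Es`), GIVEN the named facts `hS` (Perrin-Riou–Schneider, BMS Thm. 1.7) and `hSU`
(Skinner–Urban Thm. 3.6.9 for every cyclotomic datum), the newform `hf`, the census rank certificate
`hlow`, the symbol DATA `hint`/`htab` (as in the atlas series: the plus symbols of `f` are `p`-integral and
the tables ARE `D·[u/p^{n+1}]⁺`, `D·[u/p^n]⁺`, `‖D‖_p = 1`) and THE canonical height `Dh` with its certified
regulator valuation `hreg : ord_p Reg_p(E, Dh) = b` (H-side, two engines): `rank_ℤ E(ℚ) = 2`,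
`Ш(E/ℚ)[p^∞]` is finite, `Reg_p ≠ 0`, and `#Ш(E/ℚ)[p^∞] = p^k` with
`k = ord_p(A·H − L) + 2 − 2·ord_p #Ẽ(𝔽_p) − ord_p ∏c_ℓ − b`, EVERY term except `b` computed in the
kernel from the row's data. Per pair; NOT a class theorem. [cite: SkinnerUrban2014, Thm. 3.6.9 (p. 45)]
[cite: BalakrishnanMullerStein2015, Thm. 1.7] [cite: SteinWuthrich2013, §§3–4 and Alg. 11.1]
[cite: MazurTateTeitelbaum1986Invent, §I.10–I.13] -/
theorem AtlasCurve.shaRowSU {C : AtlasCurve} (h : C.check = true) {c : AtlasCell} (hc : c ∈ C.cells)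
    [Fact c.p.Prime] [(C.e.baseChange ℚ).IsElliptic] [(C.e.baseChange ℚ).IsGloballyMinimal]
    {w : SuWitness} (hw : w.check C.e c.p = true)
    {Es : List Tam.TamLocal} (hEs : Tam.TamLocal.rowCheck Es C.e = true)
    (hEx : Tam.TamLocal.rowExact Es = true)
    (hS : Schneider1985_order_charGenerator_odd) {N : ℕ} [NeZero N] {f : CuspForm (Gamma0 N) 2}
    (hf : IsNewformOf (C.e.baseChange ℚ) f)
    (hSU : ∀ (κ : ZpExtension ℚ c.p) (γ : Field.absoluteGaloisGroup ℚ),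
      skinner_urban_main_conjecture (C.e.baseChange ℚ) c.p (κ := κ) (γ := γ) (f := f))
    (hlow : 2 ≤ C.row.curve.mordellWeilRank) (D : ℚ) (hD : ‖(D : ℚ_[c.p])‖ = 1)
    (hint : ∀ x : ℚ, ‖(ratPlusSymbol f x : ℚ_[c.p])‖ ≤ 1)
    (htab : ∀ u : ℕ, u < c.p ^ (c.n + 1) → ¬ c.p ∣ u →
      ratPlusSymbol f ((u : ℚ) / (c.p : ℚ) ^ (c.n + 1)) = (c.tabHi.getD u 0 : ℚ) / D ∧
      ratPlusSymbol f ((u : ℚ) / (c.p : ℚ) ^ c.n) = (c.tabLo.getD (u % c.p ^ c.n) 0 : ℚ) / D)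
    (Dh : PAdicHeightData (C.e.baseChange ℚ) c.p) (hDh : Dh.IsCanonical) {b : ℤ}
    (hreg : (padicRegulator Dh).valuation = b) :
    C.row.curve.mordellWeilRank = 2 ∧
      Finite (AddCommGroup.primaryComponent (C.e.baseChange ℚ).sha c.p) ∧ SchneiderConjecture Dh ∧
      ∃ k : ℕ, Nat.card (AddCommGroup.primaryComponent (C.e.baseChange ℚ).sha c.p) = c.p ^ k ∧
        (k : ℤ) = padicValInt c.p (c.A * c.H - c.L) + 2 - 2 * padicValNat c.p (c.count C.e) -
          padicValNat c.p (Tam.TamLocal.rowValue Es) - b := by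
  have hk : c.check C.e = true := AtlasCurve.cell_check h hc
  have h5 := AtlasCell.five_le_of_check hk
  have hordin := AtlasCell.isOrdinaryAt_of_check hk
  have hap := AtlasCell.frobeniusTrace_of_check hk
  have hI : integralModelInt (C.e.baseChange ℚ) = C.e := AtlasCurve.integralModelInt_eq
  have hram : Ram (C.e.baseChange ℚ) c.p := SuWitness.ram_of_check hw _ hI
  have hirr : (C.e.baseChange ℚ).HasIrreducibleModPGaloisRep c.p := SuWitness.irr_of_check hw _ hI
  have hlow' : c.certL.r ≤ (C.e.baseChange ℚ).mordellWeilRank := by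
    rw [AtlasCurve.baseChange_e]; exact hlow
  have htab' : ∀ u : ℕ, u < c.p ^ (c.certL.n + 1) → ¬ c.p ∣ u →
      ratPlusSymbol f ((u : ℚ) / (c.p : ℚ) ^ (c.certL.n + 1)) = (c.certL.tabHi.getD u 0 : ℚ) / D ∧
      ratPlusSymbol f ((u : ℚ) / (c.p : ℚ) ^ c.certL.n) = (c.certL.tabLo.getD u 0 : ℚ) / D :=
    fun u hu hpu => by
      rw [AtlasCell.certL_tabLo_getD c hu]
      exact htab u hu hpu
  obtain ⟨hLp, hval⟩ := valuation_coeff_eq_of_symbolCertL c.p (C.e.baseChange ℚ) hordin hf hap c.certL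
    (AtlasCell.validL_of_check hk) D hD hint htab'
  obtain ⟨hr, hfin, hSch, k, hcard, hkval⟩ := card_shaPrimary_eq_pow_of_certificate hS
    (C.e.baseChange ℚ) c.p f hSU h5 hordin hirr hram hf hlow' hLp Dh hDh hval hreg
  refine ⟨by rw [← AtlasCurve.baseChange_e]; exact hr, hfin, hSch, k, hcard, ?_⟩
  rw [hkval, AtlasCurve.reductionPointCount_eq h hc,
    Tam.TamLocal.tamagawaProduct_eq hEs inferInstance hEx]
  rfl

/-- **ROW THEOREM, frame «kato-bound», on an atlas cell.** As `AtlasCurve.shaRowSU` but with Kato's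
Thm. 17.4 (`hK`, every cyclotomic datum) in place of Skinner–Urban and the census surjectivity bit
`hsurj : Surj W p` (Serre witnesses) in place of the (ram) witness (the `SuWitness` is not needed:
`ρ̄` surjective ⇒ `E[p]` irreducible): `rank = 2`, `Ш(E/ℚ)[p^∞]` finite, `Reg_p ≠ 0`, and
`ord_p #Ш(E/ℚ)[p^∞] ≤ ord_p(A·H − L) + 2 − 2·ord_p #Ẽ(𝔽_p) − ord_p ∏c_ℓ − b`. Per pair; NOT a class
theorem. [cite: Kato2004Asterisque, Thm. 17.4 (3) (p. 273)] [cite: BalakrishnanMullerStein2015, Thm. 1.7]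
[cite: SteinWuthrich2013, Alg. 11.1 and Prop. 11.2] -/
theorem AtlasCurve.shaRowKato {C : AtlasCurve} (h : C.check = true) {c : AtlasCell} (hc : c ∈ C.cells)
    [Fact c.p.Prime] [(C.e.baseChange ℚ).IsElliptic] [(C.e.baseChange ℚ).IsGloballyMinimal]
    {Es : List Tam.TamLocal} (hEs : Tam.TamLocal.rowCheck Es C.e = true)
    (hEx : Tam.TamLocal.rowExact Es = true)
    (hS : Schneider1985_order_charGenerator_odd) {N : ℕ} [NeZero N] {f : CuspForm (Gamma0 N) 2}
    (hf : IsNewformOf (C.e.baseChange ℚ) f)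
    (hK : ∀ (κ : ZpExtension ℚ c.p) (γ : Field.absoluteGaloisGroup ℚ),
      kato_divisibility (C.e.baseChange ℚ) c.p (κ := κ) (γ := γ) (f := f))
    (hsurj : (C.e.baseChange ℚ).HasSurjectiveModNGaloisRep c.p)
    (hlow : 2 ≤ C.row.curve.mordellWeilRank) (D : ℚ) (hD : ‖(D : ℚ_[c.p])‖ = 1)
    (hint : ∀ x : ℚ, ‖(ratPlusSymbol f x : ℚ_[c.p])‖ ≤ 1)
    (htab : ∀ u : ℕ, u < c.p ^ (c.n + 1) → ¬ c.p ∣ u →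
      ratPlusSymbol f ((u : ℚ) / (c.p : ℚ) ^ (c.n + 1)) = (c.tabHi.getD u 0 : ℚ) / D ∧
      ratPlusSymbol f ((u : ℚ) / (c.p : ℚ) ^ c.n) = (c.tabLo.getD (u % c.p ^ c.n) 0 : ℚ) / D)
    (Dh : PAdicHeightData (C.e.baseChange ℚ) c.p) (hDh : Dh.IsCanonical) {b : ℤ}
    (hreg : (padicRegulator Dh).valuation = b) :
    C.row.curve.mordellWeilRank = 2 ∧
      Finite (AddCommGroup.primaryComponent (C.e.baseChange ℚ).sha c.p) ∧ SchneiderConjecture Dh ∧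
      (padicValNat c.p (Nat.card (AddCommGroup.primaryComponent (C.e.baseChange ℚ).sha c.p)) : ℤ) ≤
        padicValInt c.p (c.A * c.H - c.L) + 2 - 2 * padicValNat c.p (c.count C.e) -
          padicValNat c.p (Tam.TamLocal.rowValue Es) - b := by
  have hk : c.check C.e = true := AtlasCurve.cell_check h hc
  have h5 := AtlasCell.five_le_of_check hk
  have hordin := AtlasCell.isOrdinaryAt_of_check hk
  have hap := AtlasCell.frobeniusTrace_of_check hk
  have hlow' : c.certL.r ≤ (C.e.baseChange ℚ).mordellWeilRank := by
    rw [AtlasCurve.baseChange_e]; exact hlow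
  have htab' : ∀ u : ℕ, u < c.p ^ (c.certL.n + 1) → ¬ c.p ∣ u →
      ratPlusSymbol f ((u : ℚ) / (c.p : ℚ) ^ (c.certL.n + 1)) = (c.certL.tabHi.getD u 0 : ℚ) / D ∧
      ratPlusSymbol f ((u : ℚ) / (c.p : ℚ) ^ c.certL.n) = (c.certL.tabLo.getD u 0 : ℚ) / D :=
    fun u hu hpu => by
      rw [AtlasCell.certL_tabLo_getD c hu]
      exact htab u hu hpu
  obtain ⟨hLp, hval⟩ := valuation_coeff_eq_of_symbolCertL c.p (C.e.baseChange ℚ) hordin hf hap c.certL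
    (AtlasCell.validL_of_check hk) D hD hint htab'
  obtain ⟨hr, hfin, hSch, hle⟩ := card_shaPrimary_le_of_kato_certificate hS (C.e.baseChange ℚ) c.p f hK
    h5 hordin hsurj hf hlow' hLp Dh hDh hval hreg
  refine ⟨by rw [← AtlasCurve.baseChange_e]; exact hr, hfin, hSch, ?_⟩
  rw [AtlasCurve.reductionPointCount_eq h hc, Tam.TamLocal.tamagawaProduct_eq hEs inferInstance hEx] at hle
  exact hle

/-- **Frame «kato-bound», the case `k ≤ 0`: `Ш(E/ℚ)[p^∞] = 0` exactly** on an atlas cell (the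
Stein–Wuthrich verdict «Ш(E/ℚ)[p] = 0»). [cite: SteinWuthrich2013, Thm. 1.1 and Alg. 11.1]
[cite: Kato2004Asterisque, Thm. 17.4 (3) (p. 273)] [cite: BalakrishnanMullerStein2015, Thm. 1.7] -/
theorem AtlasCurve.shaRowKato_eq_one {C : AtlasCurve} (h : C.check = true) {c : AtlasCell}
    (hc : c ∈ C.cells) [Fact c.p.Prime] [(C.e.baseChange ℚ).IsElliptic]
    [(C.e.baseChange ℚ).IsGloballyMinimal]
    {Es : List Tam.TamLocal} (hEs : Tam.TamLocal.rowCheck Es C.e = true)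
    (hEx : Tam.TamLocal.rowExact Es = true)
    (hS : Schneider1985_order_charGenerator_odd) {N : ℕ} [NeZero N] {f : CuspForm (Gamma0 N) 2}
    (hf : IsNewformOf (C.e.baseChange ℚ) f)
    (hK : ∀ (κ : ZpExtension ℚ c.p) (γ : Field.absoluteGaloisGroup ℚ),
      kato_divisibility (C.e.baseChange ℚ) c.p (κ := κ) (γ := γ) (f := f))
    (hsurj : (C.e.baseChange ℚ).HasSurjectiveModNGaloisRep c.p)
    (hlow : 2 ≤ C.row.curve.mordellWeilRank) (D : ℚ) (hD : ‖(D : ℚ_[c.p])‖ = 1)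
    (hint : ∀ x : ℚ, ‖(ratPlusSymbol f x : ℚ_[c.p])‖ ≤ 1)
    (htab : ∀ u : ℕ, u < c.p ^ (c.n + 1) → ¬ c.p ∣ u →
      ratPlusSymbol f ((u : ℚ) / (c.p : ℚ) ^ (c.n + 1)) = (c.tabHi.getD u 0 : ℚ) / D ∧
      ratPlusSymbol f ((u : ℚ) / (c.p : ℚ) ^ c.n) = (c.tabLo.getD (u % c.p ^ c.n) 0 : ℚ) / D)
    (Dh : PAdicHeightData (C.e.baseChange ℚ) c.p) (hDh : Dh.IsCanonical) {b : ℤ}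
    (hreg : (padicRegulator Dh).valuation = b)
    (hk0 : padicValInt c.p (c.A * c.H - c.L) + 2 - 2 * padicValNat c.p (c.count C.e) -
      padicValNat c.p (Tam.TamLocal.rowValue Es) - b ≤ 0) :
    C.row.curve.mordellWeilRank = 2 ∧
      Finite (AddCommGroup.primaryComponent (C.e.baseChange ℚ).sha c.p) ∧ SchneiderConjecture Dh ∧
      Nat.card (AddCommGroup.primaryComponent (C.e.baseChange ℚ).sha c.p) = 1 := by
  obtain ⟨hr, hfin, hSch, hle⟩ := AtlasCurve.shaRowKato h hc hEs hEx hS hf hK hsurj hlow D hD hint htab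
    Dh hDh hreg
  haveI := hfin
  have hv0 : padicValNat c.p (Nat.card (AddCommGroup.primaryComponent (C.e.baseChange ℚ).sha c.p)) = 0 := by
    have := hle.trans hk0
    omega
  have hndvd : ¬ c.p ∣ Nat.card (AddCommGroup.primaryComponent (C.e.baseChange ℚ).sha c.p) := by
    rcases padicValNat.eq_zero_iff.mp hv0 with h1 | h0 | hnd
    · exact absurd h1 (Fact.out : c.p.Prime).one_lt.ne'
    · exact absurd h0 Nat.card_pos.ne'
    · exact hnd
  exact ⟨hr, hfin, hSch, natCard_primaryComponent_eq_one c.p hndvd⟩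

end Summit.BirchSwinnertonDyer.BirchSwinnertonDyer.Rank2Sha

end
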